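import Literature.Computability.AlgebraicComplexity.MoreAsymmetricSixRegions
import Literature.Computability.AlgebraicComplexity.GlobalStageAsymptotic
import HarnessLib

/-!
# ADVXXZ Theorem 5.3, asymptotic form: the lower-order terms are `o(n)` and the `ε`-loss is `o_{1/ε}(1)`
(Alman–Duan–Vassilevska Williams–Xu–Xu–Zhou 2025, Thm. 5.3: "`2^{(∑_{r=1}^{6} E_r A_r − o_{1/ε}(1)) n − o(n)}`
independent copies of a level-`ℓ` `ε`-interface tensor … from `2^{o(n)}` independent copies") — proved

Topic `Literature/Computability/AlgebraicComplexity`.  `MoreAsymmetricEpsilon.lean` /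
`MoreAsymmetricSixRegions.lean` prove Thm. 5.3 of Alman–Duan–Vassilevska Williams–Xu–Xu–Zhou (SODA 2025,
arXiv:2404.16349) at fixed `n` with the explicit error terms `thm53Err c n` (lower order, the same as VXXZ's)
and `epsLoss₂ c ε` (the `ε`-loss, twice VXXZ's), from `inputCopies c n` copies of the input.  With the three
little-`o` statements of `GlobalStageAsymptotic.lean` (`tendsto_thm53Err_div`, `tendsto_logb_inputCopies_div`)
and `tendsto_epsLoss₂`, this file PROVES the printed form:

* `advxxz2025_thm53_asymptotic` — **for every `δ > 0` there is `ε₀ > 0` such that for all `0 < ε ≤ ε₀`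
  and all sufficiently large `n`, every region datum `D` of size `n` satisfies: `2^{δn} ≥ inputCopies`
  copies of `(CW_q^{⊗c})^{⊗n}` degenerate to `κ` copies of the `ε`-interface tensor of `D` with
  `log₂(κ+1) ≥ n (E(D) − δ)`**, `E(D) = min{H(Q_X/n) − P, H(β̄_Y) − η_Y, H(β̄_Z) − λ_Z, H(Q/n)}` — one region,
  uniformly in the datum;
* `advxxz2025_thm53_asymptotic₆` — the same for six regions and the concatenated parameter list.

Everything is proved; no definitions; no named facts.

## References

* J. Alman, R. Duan, V. Vassilevska Williams, Y. Xu, Z. Xu, R. Zhou, *More asymmetry yields faster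
  matrix multiplication*, SODA 2025, arXiv:2404.16349 (held: `paper:arxiv-2404.16349`, chunk p0015):
  Thm. 5.3 and its footnote on `o_{1/ε}`. [AlmanDuanVassilevskaWilliamsXuXuZhou2025]
* V. Vassilevska Williams, Y. Xu, Z. Xu, R. Zhou, *New bounds for matrix multiplication: from alpha
  to omega*, SODA 2024, arXiv:2307.07970, Thm. 5.3. [VassilevskaWilliamsXuXuZhou2024]
-/

noncomputable section

open scoped BigOperators Topology
open Finset Filter

namespace Literature.Computability.AlgebraicComplexity

open Literature.Barriers.MatrixMultiplication

universe u

section Asymptotic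

variable (K : Type u) [CommSemiring K] (q : ℕ) {c : ℕ}

/-- **Alman–Duan–Vassilevska Williams–Xu–Xu–Zhou, Thm. 5.3 (one region), asymptotic form.**  For every
`δ > 0` there is `ε₀ > 0` such that for all `0 < ε ≤ ε₀` there is `n₀` with: for every `n ≥ n₀` and every
region datum `D` of size `n`, `inputCopies c n ≤ 2^{δn}` independent copies of `(CW_q^{⊗c})^{⊗n}` degenerate
(restrict) to `κ` independent copies of the level-`ℓ` `ε`-interface tensor of `D` with
`log₂(κ+1) ≥ n (E(D) − δ)`, `E(D) = min{H(Q_X/n) − P, H(β̄_Y) − η_Y, H(β̄_Z) − λ_Z, H(Q/n)}` — the printed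
"`2^{o(n)}` copies … degenerate into `2^{(E₁ − o_{1/ε}(1))n − o(n)}` copies", uniformly in the datum.
[cite: AlmanDuanVassilevskaWilliamsXuXuZhou2025, Thm. 5.3] -/
theorem advxxz2025_thm53_asymptotic (hc : 0 < c) {δ : ℝ} (hδ : 0 < δ) :
    ∃ ε₀ : ℝ, 0 < ε₀ ∧ ∀ ε : ℝ, 0 < ε → ε ≤ ε₀ → ∃ n₀ : ℕ, ∀ n : ℕ, n₀ ≤ n → ∀ D : MoreAsymRegionDatum c n,
      Real.logb 2 (inputCopies c n) ≤ δ * n ∧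
      ∃ κ : ℕ,
        TensorRestrictsTo (kroneckerTensor (unitTensor K (inputCopies c n)) (kroneckerPow (kroneckerPow (bigCwTensor K q) c) n))
          (kroneckerTensor (unitTensor K κ) (interfaceTensor K q D.termMap D.termList ε)) ∧
        (n : ℝ) * (D.exponent - δ) ≤ Real.logb 2 ((κ : ℝ) + 1) := by
  obtain ⟨η, hη, hηε⟩ := Metric.tendsto_nhds_nhds.1 (tendsto_epsLoss₂ c) (δ / 2) (by positivity)
  refine ⟨min (η / 2) 1, by positivity, fun ε hε0 hεle => ?_⟩
  have hε1 : ε ≤ 1 := hεle.trans (min_le_right _ _)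
  have hεη : dist ε 0 < η := by
    rw [Real.dist_eq, sub_zero, abs_of_pos hε0]
    have := min_le_left (η / 2) 1
    linarith
  have hloss : epsLoss₂ c ε < δ / 2 := by
    have h := hηε hεη
    rw [Real.dist_eq, sub_zero] at h
    exact lt_of_abs_lt h
  obtain ⟨n₁, hn₁⟩ := Metric.tendsto_atTop.1 (tendsto_thm53Err_div hc) (δ / 2) (by positivity)
  obtain ⟨n₂, hn₂⟩ := Metric.tendsto_atTop.1 (tendsto_logb_inputCopies_div c) δ hδ
  refine ⟨max (max n₁ n₂) 1, fun n hn D => ?_⟩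
  have hn1 : n₁ ≤ n := le_trans (le_max_left _ _) (le_trans (le_max_left _ _) hn)
  have hn2 : n₂ ≤ n := le_trans (le_max_right _ _) (le_trans (le_max_left _ _) hn)
  have hnpos : 0 < n := lt_of_lt_of_le Nat.one_pos (le_trans (le_max_right _ _) hn)
  have hnR : (0 : ℝ) < n := by exact_mod_cast hnpos
  have hErr : thm53Err c n ≤ δ / 2 * n := by
    have h := hn₁ n hn1
    rw [Real.dist_eq, sub_zero] at h
    have := (abs_lt.1 h).2
    rw [div_lt_iff₀ hnR] at this
    linarith
  have hIn : Real.logb 2 (inputCopies c n) ≤ δ * n := by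
    have h := hn₂ n hn2
    rw [Real.dist_eq, sub_zero] at h
    have := (abs_lt.1 h).2
    rw [div_lt_iff₀ hnR] at this
    linarith
  refine ⟨hIn, ?_⟩
  obtain ⟨κ, hres, hb⟩ := advxxz2025_thm53_regionDatum K q hc hnpos D hε0.le hε1
  refine ⟨κ, hres, le_trans ?_ hb⟩
  have : (n : ℝ) * epsLoss₂ c ε ≤ n * (δ / 2) := mul_le_mul_of_nonneg_left hloss.le hnR.le
  nlinarith

/-- **Thm. 5.3 (six regions), asymptotic form**: for every `δ > 0` there is `ε₀ > 0` such that for all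
`0 < ε ≤ ε₀` there is `n₀` with: for all region sizes `n₁, …, n₆ ≥ n₀` and data `D₁, …, D₆`,
`N ≤ 2^{δ(n₁+⋯+n₆)}` independent copies of `(CW_q^{⊗c})^{⊗(n₁+⋯+n₆)}` degenerate to `κ₁⋯κ₆` copies of the
`ε`-interface tensor with the concatenated parameter list (region `r` in orientation `π_r`),
`log₂(κ_r+1) ≥ n_r (E_r − δ)` — the printed `2^{(∑_r A_r E_r − o_{1/ε}(1))n − o(n)}` copies from `2^{o(n)}` copies.
[cite: AlmanDuanVassilevskaWilliamsXuXuZhou2025, Thm. 5.3 and Prop. 5.1] -/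
theorem advxxz2025_thm53_asymptotic₆ (hc : 0 < c) {δ : ℝ} (hδ : 0 < δ) :
    ∃ ε₀ : ℝ, 0 < ε₀ ∧ ∀ ε : ℝ, 0 < ε → ε ≤ ε₀ → ∃ n₀ : ℕ, ∀ n₁ n₂ n₃ n₄ n₅ n₆ : ℕ,
      n₀ ≤ n₁ → n₀ ≤ n₂ → n₀ ≤ n₃ → n₀ ≤ n₄ → n₀ ≤ n₅ → n₀ ≤ n₆ →
      ∀ (D₁ : MoreAsymRegionDatum c n₁) (D₂ : MoreAsymRegionDatum c n₂) (D₃ : MoreAsymRegionDatum c n₃)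
        (D₄ : MoreAsymRegionDatum c n₄) (D₅ : MoreAsymRegionDatum c n₅) (D₆ : MoreAsymRegionDatum c n₆),
      Real.logb 2 ((inputCopies c n₁ * inputCopies c n₂ * inputCopies c n₃ * inputCopies c n₄ * inputCopies c n₅ *
          inputCopies c n₆ : ℕ) : ℝ) ≤ δ * (n₁ + n₂ + n₃ + n₄ + n₅ + n₆) ∧
      ∃ κ₁ κ₂ κ₃ κ₄ κ₅ κ₆ : ℕ,
        TensorRestrictsTo
          (kroneckerTensor (unitTensor K (inputCopies c n₁ * inputCopies c n₂ * inputCopies c n₃ * inputCopies c n₄ *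
              inputCopies c n₅ * inputCopies c n₆))
            (kroneckerPow (kroneckerPow (bigCwTensor K q) c) (n₁ + n₂ + n₃ + n₄ + n₅ + n₆)))
          (kroneckerTensor (unitTensor K (κ₁ * κ₂ * κ₃ * κ₄ * κ₅ * κ₆))
            (interfaceTensor K q
              (concatTermMap (concatTermMap (concatTermMap (concatTermMap (concatTermMap D₁.termMap D₂.termMap) D₃.termMap)
                D₄.termMap) D₅.termMap) D₆.termMap)
              (Fin.append (Fin.append (Fin.append (Fin.append (Fin.append D₁.termList (fun t => (D₂.termList t).swapYZ))
                (fun t => (D₃.termList t).swapXY)) (fun t => ((D₄.termList t).swapYZ).swapXY))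
                (fun t => ((D₅.termList t).swapXY).swapYZ)) (fun t => (D₆.termList t).swapXZ)) ε)) ∧
        (n₁ : ℝ) * (D₁.exponent - δ) ≤ Real.logb 2 ((κ₁ : ℝ) + 1) ∧
        (n₂ : ℝ) * (D₂.exponent - δ) ≤ Real.logb 2 ((κ₂ : ℝ) + 1) ∧
        (n₃ : ℝ) * (D₃.exponent - δ) ≤ Real.logb 2 ((κ₃ : ℝ) + 1) ∧
        (n₄ : ℝ) * (D₄.exponent - δ) ≤ Real.logb 2 ((κ₄ : ℝ) + 1) ∧
        (n₅ : ℝ) * (D₅.exponent - δ) ≤ Real.logb 2 ((κ₅ : ℝ) + 1) ∧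
        (n₆ : ℝ) * (D₆.exponent - δ) ≤ Real.logb 2 ((κ₆ : ℝ) + 1) := by
  obtain ⟨ε₀, hε₀, h⟩ := advxxz2025_thm53_asymptotic K q hc hδ
  refine ⟨ε₀, hε₀, fun ε hε0 hεle => ?_⟩
  obtain ⟨n₀, hn₀⟩ := h ε hε0 hεle
  refine ⟨n₀, fun n₁ n₂ n₃ n₄ n₅ n₆ hn₁ hn₂ hn₃ hn₄ hn₅ hn₆ D₁ D₂ D₃ D₄ D₅ D₆ => ?_⟩
  obtain ⟨hI₁, κ₁, h₁, b₁⟩ := hn₀ n₁ hn₁ D₁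
  obtain ⟨hI₂, κ₂, h₂, b₂⟩ := hn₀ n₂ hn₂ D₂
  obtain ⟨hI₃, κ₃, h₃, b₃⟩ := hn₀ n₃ hn₃ D₃
  obtain ⟨hI₄, κ₄, h₄, b₄⟩ := hn₀ n₄ hn₄ D₄
  obtain ⟨hI₅, κ₅, h₅, b₅⟩ := hn₀ n₅ hn₅ D₅
  obtain ⟨hI₆, κ₆, h₆, b₆⟩ := hn₀ n₆ hn₆ D₆
  refine ⟨?_, κ₁, κ₂, κ₃, κ₄, κ₅, κ₆, ?_, b₁, b₂, b₃, b₄, b₅, b₆⟩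
  · have p₁ : (0 : ℝ) < inputCopies c n₁ := by exact_mod_cast inputCopies_pos c n₁
    have p₂ : (0 : ℝ) < inputCopies c n₂ := by exact_mod_cast inputCopies_pos c n₂
    have p₃ : (0 : ℝ) < inputCopies c n₃ := by exact_mod_cast inputCopies_pos c n₃
    have p₄ : (0 : ℝ) < inputCopies c n₄ := by exact_mod_cast inputCopies_pos c n₄
    have p₅ : (0 : ℝ) < inputCopies c n₅ := by exact_mod_cast inputCopies_pos c n₅
    have p₆ : (0 : ℝ) < inputCopies c n₆ := by exact_mod_cast inputCopies_pos c n₆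
    push_cast
    rw [Real.logb_mul (by positivity) p₆.ne', Real.logb_mul (by positivity) p₅.ne',
      Real.logb_mul (by positivity) p₄.ne', Real.logb_mul (by positivity) p₃.ne', Real.logb_mul p₁.ne' p₂.ne']
    linarith
  · have h₂' := tensorRestrictsTo_inputCopies_swapYZ K q _ D₂.termMap D₂.termList ε κ₂ h₂
    have h₃' := tensorRestrictsTo_inputCopies_swapXY K q _ D₃.termMap D₃.termList ε κ₃ h₃
    have h₄' := tensorRestrictsTo_inputCopies_swapXY K q _ D₄.termMap (fun t => (D₄.termList t).swapYZ) ε κ₄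
      (tensorRestrictsTo_inputCopies_swapYZ K q _ D₄.termMap D₄.termList ε κ₄ h₄)
    have h₅' := tensorRestrictsTo_inputCopies_swapYZ K q _ D₅.termMap (fun t => (D₅.termList t).swapXY) ε κ₅
      (tensorRestrictsTo_inputCopies_swapXY K q _ D₅.termMap D₅.termList ε κ₅ h₅)
    have h₆' := tensorRestrictsTo_inputCopies_swapXZ K q _ D₆.termMap D₆.termList ε κ₆ h₆
    have h₁₂ := tensorRestrictsTo_inputCopies_mul K q D₁.termMap D₁.termList D₂.termMap (fun t => (D₂.termList t).swapYZ) ε h₁ h₂'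
    have h₁₃ := tensorRestrictsTo_inputCopies_mul K q _ _ D₃.termMap (fun t => (D₃.termList t).swapXY) ε h₁₂ h₃'
    have h₁₄ := tensorRestrictsTo_inputCopies_mul K q _ _ D₄.termMap (fun t => ((D₄.termList t).swapYZ).swapXY) ε h₁₃ h₄'
    have h₁₅ := tensorRestrictsTo_inputCopies_mul K q _ _ D₅.termMap (fun t => ((D₅.termList t).swapXY).swapYZ) ε h₁₄ h₅'
    exact tensorRestrictsTo_inputCopies_mul K q _ _ D₆.termMap (fun t => (D₆.termList t).swapXZ) ε h₁₅ h₆'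

end Asymptotic

end Literature.Computability.AlgebraicComplexity
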